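import Mathlib
import Literature.AlgebraicGeometry.Resolution.TranscendenceDefect
import Literature.AlgebraicGeometry.Resolution.Henselization
import Literature.AlgebraicGeometry.Resolution.HenselizedFunctionFields
import Summits.ResolutionOfSingularities.ResolutionOfSingularities.Theorems.DefectlessFramesDefectlessFramesRTwist
import Summits.ResolutionOfSingularities.ResolutionOfSingularities.Theorems.DefectlessFramesDefectlessFramesRSmallAxis

/-!
# The kernel of `DefectlessFramesR` follows from AXIS DROP BELOW `p` (crux stmt-ResolutionOfSingularities-17921)

Lead seat prover-line-stmt-ResolutionOfSingularities-17921-0, 2026-08-17 (cycle 1, kernel analysis).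

The only open stub of the line `Sketch` is `stub_dfrKernel`: the crux at rank-one zero-dimensional valuation
rings of POSITIVE transcendence defect that are NOT discrete, for frames of axis order `≥ p` (or not in general
position). This file records, kernel-checked, that the valuation-theoretic half of the kernel (DEFECT) is entirely
discharged by the landed stubs once the AXIS ORDER can be pushed below `p` by dominating re-framings:

`stub_dfrKernelOfAxisDrop : AxisDrop → Kernel`, where `AxisDrop` says — at the same places, for the same frames
`(y; z; f)` — that there is a dominating frame `(y₂; z₂; f₂)` (algebraically independent `y₂`, `k(y₂, z₂) = K`,
`span {f₂} = ker`, `f₂ ≠ 0`, `k[y, z] ⊆ k[y₂, z₂]`) in general position whose axis order is `< p` and not larger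
than that of `(y; z; f)`. NO integrality, separability or defect condition is asked of `(y₂; z₂; f₂)`: the Nagata
re-framing `stub_dfrTwist` makes it integral and separable keeping its axis order, and `stub_dfrSmallAxis`
(Hensel cluster budget + Ostrowski) makes every integral separable frame of axis order `< p` defectless.

So the kernel of `DefectlessFramesR` is implied by a purely GEOMETRIC statement (embedded reduction of the axis
order of a hypersurface frame below the characteristic by polynomial re-framings along the valuation — Perron /
quadratic transforms and coordinate changes are such re-framings), with no defect in it. `AxisDrop` is not claimed
to be equivalent to the kernel (a defectless frame of axis order `≥ p` is allowed by the kernel); it is the natural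
sufficient condition, and it is what Zariski–Perron style engines produce when they terminate below `p`.
-/

namespace Summit.ResolutionOfSingularities.ResolutionOfSingularities.Theorems

open Literature.AlgebraicGeometry.Resolution IsLocalRing

/-- **Axis drop below `p` implies the kernel of `DefectlessFramesR`.** Hypothesis (`AxisDrop`): at a rank-one
zero-dimensional valuation ring `O ⊇ k` (`k` perfect of characteristic `p`) of positive transcendence defect which
is not a DVR, every hypersurface frame `(y; z; f)` of axis order `≥ p` (when in general position) is dominated by a
frame `(y₂; z₂; f₂)` in general position of axis order `< p`, not exceeding that of `(y; z; f)`. Conclusion: the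
statement of the registered stub `stub_dfrKernel` (the crux at those places and frames). Proof: re-frame
`(y₂; z₂; f₂)` by `stub_dfrTwist` (integral, separable, same axis order, dominating) and apply `stub_dfrSmallAxis`.
[folklore] -/
theorem stub_dfrKernelOfAxisDrop : (∀ p : ℕ, p.Prime → ∀ (k K : Type) [Field k] [CharP k p] [PerfectField k] [Field K] [Algebra k K], (⊤ : IntermediateField k K).FG → ∀ O : ValuationSubring K, ∀ hk : (∀ c : k, algebraMap k K c ∈ O), Nonempty O.valuation.RankOne → (∀ x ∈ O, ∃ f : Polynomial k, f ≠ 0 ∧ Polynomial.aeval x f ∈ O.nonunits) → transcendenceDefect k O hk ≠ 0 → ¬ IsDiscreteValuationRing O → let ρ : k →+* ResidueField O := (residue O).comp ((algebraMap k K).codRestrict O hk); let axis : (m : ℕ) → (Fin m → O) → MvPolynomial (Fin (m + 1)) k → Polynomial (ResidueField O) := fun _ w g => MvPolynomial.eval₂ (Polynomial.C.comp ρ) (Fin.snoc (fun j => Polynomial.C (residue O (w j))) Polynomial.X) g; ∀ (n : ℕ) (y : Fin n → O) (z : O) (f : MvPolynomial (Fin (n + 1)) k), AlgebraicIndependent k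 (fun i => (y i : K)) → IntermediateField.adjoin k (Set.range (fun i => (y i : K)) ∪ {(z : K)}) = ⊤ → Ideal.span {f} = RingHom.ker (MvPolynomial.aeval (R := k) (Fin.snoc (fun i => (y i : K)) (z : K))) → f ≠ 0 → (axis n y f ≠ 0 → p ≤ (axis n y f).rootMultiplicity (residue O z)) → ∃ (y₂ : Fin n → O) (z₂ : O) (f₂ : MvPolynomial (Fin (n + 1)) k), AlgebraicIndependent k (fun i => (y₂ i : K)) ∧ IntermediateField.adjoin k (Set.range (fun i => (y₂ i : K)) ∪ {(z₂ : K)}) = ⊤ ∧ Ideal.span {f₂} = RingHom.ker (MvPolynomial.aeval (R := k) (Fin.snoc (fun i => (y₂ i : K)) (z₂ : K))) ∧ f₂ ≠ 0 ∧ (∀ i, (y i : K) ∈ Algebra.adjoin k (Set.range (fun i => (y₂ i : K)) ∪ {(z₂ : K)})) ∧ (z : K) ∈ Algebra.adjoin k (Set.range (fun i => (y₂ i : K)) ∪ {(z₂ : K)}) ∧ axis n y₂ f₂ ≠ 0 ∧ (axis n y₂ f₂).rootMultiplicity (residue O z₂) < p ∧ (axis n y f ≠ 0 → (axis n y₂ f₂).rootMultiplicity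 (residue O z₂) ≤ (axis n y f).rootMultiplicity (residue O z))) → (∀ p : ℕ, p.Prime → ∀ (k K : Type) [Field k] [CharP k p] [PerfectField k] [Field K] [Algebra k K], (⊤ : IntermediateField k K).FG → ∀ O : ValuationSubring K, ∀ hk : (∀ c : k, algebraMap k K c ∈ O), Nonempty O.valuation.RankOne → (∀ x ∈ O, ∃ f : Polynomial k, f ≠ 0 ∧ Polynomial.aeval x f ∈ O.nonunits) → transcendenceDefect k O hk ≠ 0 → ¬ IsDiscreteValuationRing O → let ρ : k →+* ResidueField O := (residue O).comp ((algebraMap k K).codRestrict O hk); let axis : (m : ℕ) → (Fin m → O) → MvPolynomial (Fin (m + 1)) k → Polynomial (ResidueField O) := fun _ w g => MvPolynomial.eval₂ (Polynomial.C.comp ρ) (Fin.snoc (fun j => Polynomial.C (residue O (w j))) Polynomial.X) g; ∀ (n : ℕ) (y : Fin n → O) (z : O) (f : MvPolynomial (Fin (n + 1)) k), AlgebraicIndependent k (fun i => (y i : K)) → IntermediateField.adjoin k (Set.range (fun i => (y i : K)) ∪ {(z : K)}) = ⊤ → Ideal.span {f} = RingHom.ker (MvPolynomial.aeval (R := k)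 (Fin.snoc (fun i => (y i : K)) (z : K))) → f ≠ 0 → (axis n y f ≠ 0 → p ≤ (axis n y f).rootMultiplicity (residue O z)) → ∃ (y' : Fin n → O) (z' : O) (f' : MvPolynomial (Fin (n + 1)) k), AlgebraicIndependent k (fun i => (y' i : K)) ∧ IsIntegral (Algebra.adjoin k (Set.range fun i => (y' i : K))) (z' : K) ∧ IntermediateField.adjoin k (Set.range (fun i => (y' i : K)) ∪ {(z' : K)}) = ⊤ ∧ Ideal.span {f'} = RingHom.ker (MvPolynomial.aeval (R := k) (Fin.snoc (fun i => (y' i : K)) (z' : K))) ∧ (∀ i, (y i : K) ∈ Algebra.adjoin k (Set.range (fun i => (y' i : K)) ∪ {(z' : K)})) ∧ (z : K) ∈ Algebra.adjoin k (Set.range (fun i => (y' i : K)) ∪ {(z' : K)}) ∧ axis n y' f' ≠ 0 ∧ (axis n y f ≠ 0 → (axis n y' f').rootMultiplicity (residue O z') ≤ (axis n y f).rootMultiplicity (residue O z)) ∧ IsSeparable (IntermediateField.adjoin k (Set.range fun i => (y' i : K))) (z' : K) ∧ ∀ (Ω : Type) [Field Ω] [Algebra K Ω] [IsAlgClosure K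 Ω] (V : ValuationSubring Ω), V.comap (algebraMap K Ω) = O → let F : Subfield Ω := (IntermediateField.adjoin k (Set.range fun i => (y' i : K))).toSubfield.map (algebraMap K Ω); IsDefectlessExtension V (henselization V F) (henselization V F ⊔ (algebraMap K Ω).fieldRange)) := by
  intro hAD p hp k K _ _ _ _ _ hfg O hk hR hZ hD hdisc ρ axis n y z f hy hadj hker hf hs
  obtain ⟨y₂, z₂, f₂, hy₂, hadj₂, hker₂, hf₂, hdomy, hdomz, hax₂, hlt, hle⟩ :=
    hAD p hp k K hfg O hk hR hZ hD hdisc n y z f hy hadj hker hf hs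
  obtain ⟨y', z', f', h1, h2, h3, h4, h5, h6, h7, h8, h9⟩ :=
    stub_dfrTwist p hp k K hfg O hk hR hZ n y₂ z₂ f₂ hy₂ hadj₂ hker₂ hf₂
  have h8' : (axis n y' f').rootMultiplicity (IsLocalRing.residue O z') ≤
      (axis n y₂ f₂).rootMultiplicity (IsLocalRing.residue O z₂) := h8 hax₂
  have hsub : Algebra.adjoin k (Set.range (fun i => (y₂ i : K)) ∪ {(z₂ : K)}) ≤
      Algebra.adjoin k (Set.range (fun i => (y' i : K)) ∪ {(z' : K)}) := by
    refine Algebra.adjoin_le ?_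
    rintro x (⟨i, rfl⟩ | hx)
    · exact h5 i
    · rw [Set.mem_singleton_iff] at hx
      rw [hx]
      exact h6
  refine ⟨y', z', f', h1, h2, h3, h4, fun i => hsub (hdomy i), hsub hdomz, h7,
    fun hax => h8'.trans (hle hax), h9, fun Ω _ _ _ V hV => ?_⟩
  exact stub_dfrSmallAxis p hp k K hfg O hk hR hZ n y' z' f' h1 h2 h3 h4 h7 h9 (lt_of_le_of_lt h8' hlt) Ω V hV

end Summit.ResolutionOfSingularities.ResolutionOfSingularities.Theorems
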